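import Mathlib
import HarnessLib
import Summits.FinalStateConjecture.Statement
import Literature.Geometry.Lorentzian.LandauLifshitzPseudotensor

/-!
# Route EIHFluxBalance — `InertialRecession`, line `sublinear-is-free-clean-window-charges`:
# determinant and inverse of the Kerr–Schild components (helpers for `stub_chargeModel`, identification)

Helper file (`--supports stmt-FinalStateConjecture-10166`) for the crux
`Summit.FinalStateConjecture.FinalStateConjecture.Theses.EIHFluxBalance.InertialRecession`.

The Landau–Lifshitz charges of a Kerr–Schild field `g = η + 2H ℓ ⊗ ℓ` (`ℓ` null for `η`) are computed
from its superpotential `H^{μανβ} = (−g)(g^{μν}g^{αβ} − g^{αν}g^{μβ})`, and the point of the Kerr–Schild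
form is that both ingredients are EXPLICIT and polynomial: `det (g_{μν}) = −1` and
`g^{μν} = η^{μν} − 2H ℓ^μ ℓ^ν` (`ℓ^μ = η^{μν} ℓ_ν`). This file proves these two facts at the level of the
matrix API of `LandauLifshitzPseudotensor.lean` (`gram`, `metricDet`, `upper`), first for an abstract null
covector (`det_minkowski_add_null`, `inv_minkowski_add_null`) and then for the Kerr–Schild form of every
`(M, a)` at every point with `r > 0` (`gram_kerr`, `metricDet_kerr`, `upper_kerr`).
-/

set_option linter.dupNamespace false

noncomputable section

open scoped Matrix BigOperators
open Literature.Geometry.Lorentzian Literature.Geometry.Lorentzian.LandauLifshitz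

namespace Summit.FinalStateConjecture.FinalStateConjecture.Theorems

namespace KSMatrix

/-- The Minkowski matrix `diag(−1, 1, 1, 1)` (explicit lambda behind a local notation). -/
local notation "ηM" => (Matrix.diagonal ![(-1 : ℝ), 1, 1, 1])

/-! ### Abstract Kerr–Schild matrices -/

/-- The matrix of `gram_minkowski` is `ηM`. [folklore] -/
theorem eta_eq : (Matrix.diagonal fun μ : Fin 4 ↦ if μ = 0 then (-1 : ℝ) else 1) = ηM := by
  congr 1
  funext μ
  fin_cases μ <;> simp

/-- The `η`-raised vector of a covector: `l♯ = (−l₀, l₁, l₂, l₃)`. [folklore] -/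
theorem mulVec_eta (l : Fin 4 → ℝ) : (ηM).mulVec l = ![-l 0, l 1, l 2, l 3] := by
  funext μ
  rw [Matrix.mulVec_diagonal]
  fin_cases μ <;> simp

/-- `η² = 1`. [folklore] -/
theorem eta_mul_eta : (ηM) * (ηM) = 1 := by
  rw [Matrix.diagonal_mul_diagonal, ← Matrix.diagonal_one]
  congr 1
  funext μ
  fin_cases μ <;> simp

/-- `det η = −1`. [folklore] -/
theorem det_eta : (ηM).det = -1 := by
  rw [Matrix.det_diagonal, Fin.prod_univ_four]
  simp

/-- `η` is symmetric: `l ᵥ* η = η *ᵥ l`. [folklore] -/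
theorem vecMul_eta (l : Fin 4 → ℝ) : Matrix.vecMul l (ηM) = (ηM).mulVec l := by
  funext μ
  rw [Matrix.vecMul_diagonal, Matrix.mulVec_diagonal, mul_comm]

/-- For an `η`-null covector, `l ⬝ᵥ l♯ = η(l, l) = 0`. [folklore] -/
theorem dotProduct_eta_mulVec_self (l : Fin 4 → ℝ)
    (hl : -(l 0) ^ 2 + (l 1) ^ 2 + (l 2) ^ 2 + (l 3) ^ 2 = 0) :
    l ⬝ᵥ (ηM).mulVec l = 0 := by
  rw [mulVec_eta, dotProduct, Fin.sum_univ_four]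
  simp only [Fin.isValue, Matrix.cons_val_zero, Matrix.cons_val_one, Matrix.cons_val]
  linear_combination hl

/-- A Kerr–Schild matrix factors through `η`: `η + c l ⊗ l = η (1 + (c l♯) ⊗ l)`. [folklore] -/
theorem minkowski_add_null_eq_mul (c : ℝ) (l : Fin 4 → ℝ) :
    ηM + c • Matrix.vecMulVec l l = (ηM) * (1 + Matrix.vecMulVec (c • (ηM).mulVec l) l) := by
  rw [mul_add, mul_one, Matrix.mul_vecMulVec, Matrix.mulVec_smul, Matrix.mulVec_mulVec, eta_mul_eta,
    Matrix.one_mulVec, Matrix.smul_vecMulVec]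

/-- **Determinant of a Kerr–Schild matrix**: for an `η`-null covector `l`, `det (η + c l ⊗ l) = −1`
(matrix determinant lemma: `det (1 + u ⊗ v) = 1 + v ⬝ u`, and `l ⬝ l♯ = 0`). [folklore] -/
theorem det_minkowski_add_null (c : ℝ) (l : Fin 4 → ℝ)
    (hl : -(l 0) ^ 2 + (l 1) ^ 2 + (l 2) ^ 2 + (l 3) ^ 2 = 0) :
    (ηM + c • Matrix.vecMulVec l l).det = -1 := by
  rw [minkowski_add_null_eq_mul, Matrix.det_mul, det_eta, Matrix.vecMulVec_eq (Fin 1),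
    Matrix.det_one_add_replicateCol_mul_replicateRow, dotProduct_smul, dotProduct_eta_mulVec_self l hl,
    smul_zero, add_zero, mul_one]

/-- **Inverse of a Kerr–Schild matrix**: for an `η`-null covector `l`,
`(η + c l ⊗ l)(η − c l♯ ⊗ l♯) = 1` with `l♯ = η l` (the cross terms cancel and the quartic term carries
the factor `η(l, l) = 0`). [folklore] -/
theorem minkowski_add_null_mul (c : ℝ) (l : Fin 4 → ℝ)
    (hl : -(l 0) ^ 2 + (l 1) ^ 2 + (l 2) ^ 2 + (l 3) ^ 2 = 0) :
    (ηM + c • Matrix.vecMulVec l l) * (ηM - c • Matrix.vecMulVec ((ηM).mulVec l) ((ηM).mulVec l)) = 1 := by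
  have h1 : (ηM) * Matrix.vecMulVec ((ηM).mulVec l) ((ηM).mulVec l) = Matrix.vecMulVec l ((ηM).mulVec l) := by
    rw [Matrix.mul_vecMulVec, Matrix.mulVec_mulVec, eta_mul_eta, Matrix.one_mulVec]
  have h2 : Matrix.vecMulVec l l * (ηM) = Matrix.vecMulVec l ((ηM).mulVec l) := by
    rw [Matrix.vecMulVec_mul, vecMul_eta]
  have h3 : Matrix.vecMulVec l l * Matrix.vecMulVec ((ηM).mulVec l) ((ηM).mulVec l) = 0 := by
    rw [Matrix.vecMulVec_mul_vecMulVec, dotProduct_eta_mulVec_self l hl, zero_smul]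
    ext i j
    simp [Matrix.vecMulVec_apply]
  rw [add_mul, mul_sub, mul_sub, eta_mul_eta, Matrix.mul_smul, h1, Matrix.smul_mul, h2, Matrix.smul_mul,
    Matrix.mul_smul, h3, smul_zero, smul_zero, sub_zero]
  abel

/-- Hence `(η + c l ⊗ l)⁻¹ = η − c l♯ ⊗ l♯` (`Matrix.inv`). [folklore] -/
theorem inv_minkowski_add_null (c : ℝ) (l : Fin 4 → ℝ)
    (hl : -(l 0) ^ 2 + (l 1) ^ 2 + (l 2) ^ 2 + (l 3) ^ 2 = 0) :
    (ηM + c • Matrix.vecMulVec l l)⁻¹ = ηM - c • Matrix.vecMulVec ((ηM).mulVec l) ((ηM).mulVec l) :=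
  Matrix.inv_eq_right_inv (minkowski_add_null_mul c l hl)

/-! ### The Kerr–Schild form of `(M, a)` -/

/-- The Kerr–Schild covector on the coordinate basis: `ℓ(∂_κ) = ℓ_κ`. [cite: KerrSchild1965] -/
theorem nullCovector_basisVector (a : ℝ) (x : E4) (κ : Fin 4) :
    Kerr.nullCovector a x (E4.basisVector κ) = Kerr.nullCovectorFun a x κ := by
  rw [Kerr.nullCovector, E4.covector_apply, Fin.sum_univ_four]
  fin_cases κ <;> simp [E4.basisVector]

/-- **The Gram matrix of the Kerr–Schild form** in the coordinate basis:
`(g_{μν}(x)) = η + 2H(x) ℓ(x) ⊗ ℓ(x)` with `ℓ = nullCovectorFun a x`. [cite: KerrSchild1965] -/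
theorem gram_kerr (M a : ℝ) (x : E4) :
    gram (fun y ↦ Kerr.bilin M a y) x =
      ηM + (2 * Kerr.scalarH M a x) • Matrix.vecMulVec (Kerr.nullCovectorFun a x) (Kerr.nullCovectorFun a x) := by
  rw [← eta_eq, ← gram_minkowski x]
  ext μ ν
  rw [Matrix.add_apply, gram_apply, gram_apply, Kerr.bilin_apply, Matrix.smul_apply, Matrix.vecMulVec_apply,
    smul_eq_mul, nullCovector_basisVector, nullCovector_basisVector]

/-- The Kerr–Schild covector is `η`-null where `r > 0`, in components. [cite: KerrSchild1965] -/
theorem nullCovectorFun_null {a : ℝ} {x : E4} (hx : 0 < Kerr.radius a x) :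
    -(Kerr.nullCovectorFun a x 0) ^ 2 + (Kerr.nullCovectorFun a x 1) ^ 2 + (Kerr.nullCovectorFun a x 2) ^ 2 +
      (Kerr.nullCovectorFun a x 3) ^ 2 = 0 := by
  have h := Kerr.nullCovector_nullVector hx
  rw [Kerr.nullCovector, E4.covector_apply, Fin.sum_univ_four] at h
  have e : ∀ μ : Fin 4, (Kerr.nullVector a x) μ =
      if μ = 0 then -Kerr.nullCovectorFun a x μ else Kerr.nullCovectorFun a x μ := fun μ ↦ rfl
  simp only [e, Fin.isValue, ↓reduceIte, one_ne_zero, Fin.reduceEq] at h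
  linear_combination h

/-- **`det (g_{μν}) = −1` for the Kerr–Schild form** at every point with `r > 0` (unimodular Kerr–Schild
coordinates; LL use `−g = 1` throughout §104–§105). [cite: KerrSchild1965] -/
theorem metricDet_kerr (M a : ℝ) {x : E4} (hx : 0 < Kerr.radius a x) :
    metricDet (fun y ↦ Kerr.bilin M a y) x = -1 := by
  rw [metricDet, gram_kerr]
  exact det_minkowski_add_null _ _ (nullCovectorFun_null hx)

/-- **`g^{μν} = η^{μν} − 2H ℓ^μ ℓ^ν` for the Kerr–Schild form** at every point with `r > 0`
(`ℓ^μ = η^{μν}ℓ_ν`). [cite: KerrSchild1965] -/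
theorem upper_kerr (M a : ℝ) {x : E4} (hx : 0 < Kerr.radius a x) :
    upper (fun y ↦ Kerr.bilin M a y) x =
      ηM - (2 * Kerr.scalarH M a x) •
        Matrix.vecMulVec ((ηM).mulVec (Kerr.nullCovectorFun a x)) ((ηM).mulVec (Kerr.nullCovectorFun a x)) := by
  rw [upper, gram_kerr]
  exact inv_minkowski_add_null _ _ (nullCovectorFun_null hx)

end KSMatrix

/-- Registered sub-goal form (stub `metricDet_kerrSchild_eq_neg_one` of the crux item) of
`KSMatrix.metricDet_kerr`: the Kerr–Schild components are unimodular, `det (g_{μν}) = −1`, wherever `r > 0`.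
[cite: KerrSchild1965] -/
theorem metricDet_kerrSchild_eq_neg_one : open Literature.Geometry.Lorentzian in ∀ (M a : ℝ) {x : E4}, 0 < Kerr.radius a x → LandauLifshitz.metricDet (fun y ↦ Kerr.bilin M a y) x = -1 :=
  fun M a _ hx ↦ KSMatrix.metricDet_kerr M a hx

end Summit.FinalStateConjecture.FinalStateConjecture.Theorems

end
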